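import Literature.Geometry.Riemannian.DeformedCylinderMetric
import Literature.Geometry.Lorentzian.CurvatureContinuity
import Literature.Geometry.Lorentzian.MetricValCongr
import HarnessLib

/-!
# The scalar curvature of the conformally deformed cylinders `e^{δφ} g_t + dt²` depends
# continuously on `(point, δ)` (Bär–Hanke 2023, §3, proof of Prop. 28)

Topic `Literature/Geometry/Riemannian`. Second brick of the proof of
`Literature.Geometry.Riemannian.BarHanke2023_prop28_meanCurvatureIncrease`. Bär–Hanke, proof of
Prop. 28: "For `δ → 0` we have `f^δ(ξ, s) → g(ξ)` in the weak `C^∞`-topology … In particular, for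
sufficiently small `δ`, the `f^δ(ξ, s)` are positive definite … and satisfy
`scal_{f^δ(ξ,s)} > σ`." In the tree the scalar curvature is a pointwise object with no built-in
dependence on parameters; we obtain the needed joint continuity of
`(p, δ) ↦ scal_{Γ_δ}(p)` for the family `Γ_δ = e^{δ φ} g_t + dt²` (`DeformedCylinderMetric.lean`)
by a **suspension**: the metric `𝔊 = Γ_δ + dδ²` on `(N × ℝ) × ℝ` is a smooth Riemannian
generalized cylinder over the boundaryless base `N × ℝ` whose slices are the `Γ_δ`, so the
tree's generalized-cylinder formula (`cyl_scalarCurvature_eq`, Bär–Gauduchon–Moroianu 2005,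
Prop. 4.1 = Bär–Hanke (9)) in the `δ`-direction gives
`scal_{Γ_δ}(p) = scal_𝔊(p, δ) + |K|² + H² + 2∂_δ H` with the EXPLICIT slice data
`K = ½ φ · (Γ_δ − dt²)`, `H = ½ φ dim N` (constant in `δ`), `|K|² = ¼ φ² dim N`:

* `exists_suspension` — the smooth Riemannian metric `𝔊` on `(N × ℝ) × ℝ` with values
  `F(q) G(V₁, W₁) + (1 − F(q)) V₁₂ W₁₂ + V₂ W₂` for a positive smooth `F`;
* `trace_hor_eq_finrank`, `normSq_hor_eq_finrank` — for a metric `Γ = γ + dt²` on `N × ℝ` with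
  the cylinder property, `tr_Γ(Γ − dt²) = dim N = |Γ − dt²|²_Γ` (pointwise linear algebra);
* `scalarCurvature_eq_suspension` — `scal_{Γ_δ}(p) = scal_𝔊(p, δ) + ¼ d(d+1) φ(p)²`;
* `continuous_scalarCurvature_family` — hence `(p, δ) ↦ scal_{Γ_δ}(p)` is continuous
  (`continuous_scalarCurvature_of_two_le` for `𝔊`).

Everything is proved; no definitions, no named facts (D-0026).

## References

* C. Bär, B. Hanke, *Boundary conditions for scalar curvature*, arXiv:2012.09127, §3, (9) and
  proof of Prop. 28. [BarHanke2023]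
* C. Bär, P. Gauduchon, A. Moroianu, *Generalized cylinders in semi-Riemannian and spin
  geometry*, Math. Z. 249 (2005), Prop. 4.1. [folklore]
* B. O'Neill, *Semi-Riemannian geometry* (1983), Ch. 3, pp. 60–61 (metric contraction).
  [ONeill1983]
-/

noncomputable section

open Bundle Set Filter Function Metric
open scoped Manifold ContDiff Topology RealInnerProductSpace

namespace Literature.Geometry.Riemannian

open Literature.Geometry.Lorentzian
open Literature.Geometry.Lorentzian.PseudoRiemannianMetric

variable {E' : Type*} [NormedAddCommGroup E'] [NormedSpace ℝ E'] [FiniteDimensional ℝ E']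
  {H' : Type*} [TopologicalSpace H'] {I' : ModelWithCorners ℝ E' H'} [I'.Boundaryless]
  {N : Type*} [TopologicalSpace N] [ChartedSpace H' N] [IsManifold I' ∞ N]

/-! ### Pointwise linear algebra: `tr_Γ(Γ − dt²) = dim N = |Γ − dt²|²` -/

section Hor

variable (Γ : PseudoRiemannianMetric (I'.prod 𝓘(ℝ, ℝ)) ∞ (E' × ℝ)
    (TangentSpace (I'.prod 𝓘(ℝ, ℝ)) : N × ℝ → Type _))
  (hΓcyl : ∀ (p : N × ℝ) (v w : TangentSpace (I'.prod 𝓘(ℝ, ℝ)) p),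
    Γ.val p v w = Γ.val p ((v.1, 0) : TangentSpace (I'.prod 𝓘(ℝ, ℝ)) p)
      ((w.1, 0) : TangentSpace (I'.prod 𝓘(ℝ, ℝ)) p) + v.2 * w.2)

omit [FiniteDimensional ℝ E'] [I'.Boundaryless] in
include hΓcyl in
/-- `Γ(∂_t, w) = w₂` on a cylinder. [folklore] -/
theorem cyl_val_inr_eq_snd (p : N × ℝ) (w : TangentSpace (I'.prod 𝓘(ℝ, ℝ)) p) :
    Γ.val p (((0 : E'), (1 : ℝ)) : TangentSpace (I'.prod 𝓘(ℝ, ℝ)) p) w = w.2 := by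
  rw [hΓcyl]
  have h0 := cyl_val_mk_zero_left Γ p ((w.1, 0) : TangentSpace (I'.prod 𝓘(ℝ, ℝ)) p)
  have h' : Γ.val p ((((0 : E'), (1 : ℝ)) : TangentSpace (I'.prod 𝓘(ℝ, ℝ)) p).1, 0)
      ((w.1, 0) : TangentSpace (I'.prod 𝓘(ℝ, ℝ)) p) = 0 := h0
  rw [h']
  show 0 + (1 : ℝ) * w.2 = w.2
  ring

omit [I'.Boundaryless] in
include hΓcyl in
/-- **`tr_Γ(Γ − dt²) = dim N`** for a metric `Γ` on `N × ℝ` with the cylinder property: raising an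
index turns `Γ − dt²` into `id − θ ⊗ ∂_t` with `θ(v) = v₂` (`♯θ = ∂_t` as `Γ(∂_t, ·) = θ`), and
`tr(θ ⊗ ∂_t) = θ(∂_t) = 1`. O'Neill 1983, Ch. 3, pp. 60–61. [cite: ONeill1983, Ch. 3, pp. 60–61] -/
theorem trace_hor_eq_finrank (p : N × ℝ) (B : LinearMap.BilinForm ℝ (TangentSpace (I'.prod 𝓘(ℝ, ℝ)) p))
    (hB : ∀ v w, B v w = Γ.val p v w - v.2 * w.2) :
    Γ.trace p B = Module.finrank ℝ E' := by
  haveI : FiniteDimensional ℝ (TangentSpace (I'.prod 𝓘(ℝ, ℝ)) p) :=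
    inferInstanceAs (FiniteDimensional ℝ (E' × ℝ))
  set θ : TangentSpace (I'.prod 𝓘(ℝ, ℝ)) p →ₗ[ℝ] ℝ := LinearMap.snd ℝ E' ℝ with hθ
  set T₀ : TangentSpace (I'.prod 𝓘(ℝ, ℝ)) p := (((0 : E'), (1 : ℝ)) : TangentSpace (I'.prod 𝓘(ℝ, ℝ)) p)
    with hT₀
  have hθT : θ T₀ = 1 := rfl
  have hflat : Γ.flat p T₀ = θ := by
    refine LinearMap.ext fun w ↦ ?_
    rw [flat_apply]
    exact cyl_val_inr_eq_snd Γ hΓcyl p w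
  have hsharp : Γ.sharp p θ = T₀ := by rw [← hflat, sharp_flat]
  have hBeq : B = Γ.toBilinForm p - LinearMap.BilinForm.linMulLin θ θ := by
    refine LinearMap.ext fun v ↦ LinearMap.ext fun w ↦ ?_
    rw [LinearMap.sub_apply, LinearMap.sub_apply, toBilinForm_apply,
      LinearMap.BilinForm.linMulLin_apply, hB]
    rfl
  have hR : (Γ.sharp p).toLinearMap ∘ₗ (LinearMap.BilinForm.linMulLin θ θ) = θ.smulRight T₀ := by
    refine LinearMap.ext fun v ↦ ?_
    have hv : (LinearMap.BilinForm.linMulLin θ θ) v = θ v • θ := by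
      refine LinearMap.ext fun w ↦ ?_
      rw [LinearMap.BilinForm.linMulLin_apply, LinearMap.smul_apply, smul_eq_mul]
    rw [LinearMap.comp_apply, hv, LinearEquiv.coe_coe, map_smul, hsharp, LinearMap.smulRight_apply]
  rw [hBeq, PseudoRiemannianMetric.trace, LinearMap.comp_sub, map_sub, sharp_comp_toBilinForm,
    LinearMap.trace_id, hR, LinearMap.trace_smulRight, hθT]
  have hdim : Module.finrank ℝ (TangentSpace (I'.prod 𝓘(ℝ, ℝ)) p) = Module.finrank ℝ E' + 1 :=
    finrank_cylModel
  rw [hdim]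
  push_cast
  ring

omit [I'.Boundaryless] in
include hΓcyl in
/-- **`|Γ − dt²|²_Γ = dim N`** for a metric `Γ` on `N × ℝ` with the cylinder property:
`♯(Γ − dt²) = id − R` with `R = θ ⊗ ∂_t` idempotent of trace `1`, and `Γ − dt²` is symmetric,
so `|Γ − dt²|² = tr((id − R)²) = tr(id − R) = dim N`. O'Neill 1983, Ch. 3, pp. 60–61.
[cite: ONeill1983, Ch. 3, pp. 60–61] -/
theorem normSq_hor_eq_finrank (p : N × ℝ) (B : LinearMap.BilinForm ℝ (TangentSpace (I'.prod 𝓘(ℝ, ℝ)) p))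
    (hB : ∀ v w, B v w = Γ.val p v w - v.2 * w.2) :
    Γ.normSq p B = Module.finrank ℝ E' := by
  haveI : FiniteDimensional ℝ (TangentSpace (I'.prod 𝓘(ℝ, ℝ)) p) :=
    inferInstanceAs (FiniteDimensional ℝ (E' × ℝ))
  set θ : TangentSpace (I'.prod 𝓘(ℝ, ℝ)) p →ₗ[ℝ] ℝ := LinearMap.snd ℝ E' ℝ with hθ
  set T₀ : TangentSpace (I'.prod 𝓘(ℝ, ℝ)) p := (((0 : E'), (1 : ℝ)) : TangentSpace (I'.prod 𝓘(ℝ, ℝ)) p)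
    with hT₀
  have hθT : θ T₀ = 1 := rfl
  have hflat : Γ.flat p T₀ = θ := by
    refine LinearMap.ext fun w ↦ ?_
    rw [flat_apply]
    exact cyl_val_inr_eq_snd Γ hΓcyl p w
  have hsharp : Γ.sharp p θ = T₀ := by rw [← hflat, sharp_flat]
  have hBeq : B = Γ.toBilinForm p - LinearMap.BilinForm.linMulLin θ θ := by
    refine LinearMap.ext fun v ↦ LinearMap.ext fun w ↦ ?_
    rw [LinearMap.sub_apply, LinearMap.sub_apply, toBilinForm_apply,
      LinearMap.BilinForm.linMulLin_apply, hB]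
    rfl
  have hBflip : B.flip = B := by
    refine LinearMap.ext fun v ↦ LinearMap.ext fun w ↦ ?_
    show B w v = B v w
    rw [hB, hB, Γ.symm p w v, mul_comm w.2 v.2]
  set R : TangentSpace (I'.prod 𝓘(ℝ, ℝ)) p →ₗ[ℝ] TangentSpace (I'.prod 𝓘(ℝ, ℝ)) p := θ.smulRight T₀
    with hRdef
  have hR : (Γ.sharp p).toLinearMap ∘ₗ (LinearMap.BilinForm.linMulLin θ θ) = R := by
    refine LinearMap.ext fun v ↦ ?_
    have hv : (LinearMap.BilinForm.linMulLin θ θ) v = θ v • θ := by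
      refine LinearMap.ext fun w ↦ ?_
      rw [LinearMap.BilinForm.linMulLin_apply, LinearMap.smul_apply, smul_eq_mul]
    rw [LinearMap.comp_apply, hv, LinearEquiv.coe_coe, map_smul, hsharp, hRdef,
      LinearMap.smulRight_apply]
  have hRR : R ∘ₗ R = R := by
    refine LinearMap.ext fun v ↦ ?_
    rw [LinearMap.comp_apply, hRdef, LinearMap.smulRight_apply, LinearMap.smulRight_apply,
      map_smul, hθT, smul_eq_mul, mul_one]
  have hSB : (Γ.sharp p).toLinearMap ∘ₗ B = LinearMap.id - R := by
    rw [hBeq, LinearMap.comp_sub, sharp_comp_toBilinForm, hR]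
  have hsq : (LinearMap.id - R) ∘ₗ (LinearMap.id - R) = LinearMap.id - R := by
    rw [LinearMap.sub_comp, LinearMap.id_comp, LinearMap.comp_sub, LinearMap.comp_id, hRR, sub_self,
      sub_zero]
  rw [PseudoRiemannianMetric.normSq, hBflip, hSB, hsq, map_sub, LinearMap.trace_id, hRdef,
    LinearMap.trace_smulRight, hθT]
  have hdim : Module.finrank ℝ (TangentSpace (I'.prod 𝓘(ℝ, ℝ)) p) = Module.finrank ℝ E' + 1 :=
    finrank_cylModel
  rw [hdim]
  push_cast
  ring

end Hor

/-! ### The suspension metric `𝔊 = Γ_δ + dδ²` on `(N × ℝ) × ℝ` -/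

section Suspension

variable (G : PseudoRiemannianMetric (I'.prod 𝓘(ℝ, ℝ)) ∞ (E' × ℝ)
    (TangentSpace (I'.prod 𝓘(ℝ, ℝ)) : N × ℝ → Type _))

omit [FiniteDimensional ℝ E'] [I'.Boundaryless] in
set_option synthInstance.maxHeartbeats 400000 in
set_option maxHeartbeats 1600000 in
/-- **The suspension of the deformed cylinders**: for a Riemannian metric `G` on `N × ℝ` with the
cylinder property and a positive `C^∞` function `F` on `(N × ℝ) × ℝ` there is a Riemannian `C^∞`
metric `𝔊` on `(N × ℝ) × ℝ` with the cylinder property in the last variable and values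
`𝔊_q(V, W) = F(q) G_{q₁}(V₁, W₁) + (1 − F(q)) V₁₂ W₁₂ + V₂ W₂`, i.e. `𝔊 = F · g_t + dt² + dδ²`
whose `δ`-slices are the deformed cylinders `F(·, δ) · g_t + dt²` of `exists_cylDeform`.
Construction: `F • pr₁^*G + (1 − F) • (pr₂ ∘ pr₁)^* du² + pr₂^* du²` with `du²` the Euclidean
metric of `ℝ` (smooth pullbacks, `contMDiff_pullbackBilin_holds`). (A device to read the
parameter dependence of Bär–Hanke's deformation through a single smooth metric.)
[cite: BarHanke2023, §3, proof of Prop. 28] -/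
theorem exists_suspension (hG : G.IsRiemannian)
    (hcyl : ∀ (p : N × ℝ) (v w : TangentSpace (I'.prod 𝓘(ℝ, ℝ)) p),
      G.val p v w = G.val p ((v.1, 0) : TangentSpace (I'.prod 𝓘(ℝ, ℝ)) p)
        ((w.1, 0) : TangentSpace (I'.prod 𝓘(ℝ, ℝ)) p) + v.2 * w.2)
    (F : (N × ℝ) × ℝ → ℝ) (hF : ContMDiff ((I'.prod 𝓘(ℝ, ℝ)).prod 𝓘(ℝ, ℝ)) 𝓘(ℝ, ℝ) ∞ F)
    (hpos : ∀ q, 0 < F q) :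
    ∃ 𝔊 : PseudoRiemannianMetric ((I'.prod 𝓘(ℝ, ℝ)).prod 𝓘(ℝ, ℝ)) ∞ ((E' × ℝ) × ℝ)
        (TangentSpace ((I'.prod 𝓘(ℝ, ℝ)).prod 𝓘(ℝ, ℝ)) : (N × ℝ) × ℝ → Type _),
      𝔊.IsRiemannian ∧
      (∀ (q : (N × ℝ) × ℝ) (V W : TangentSpace ((I'.prod 𝓘(ℝ, ℝ)).prod 𝓘(ℝ, ℝ)) q),
        𝔊.val q V W = 𝔊.val q ((V.1, 0) : TangentSpace ((I'.prod 𝓘(ℝ, ℝ)).prod 𝓘(ℝ, ℝ)) q)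
          ((W.1, 0) : TangentSpace ((I'.prod 𝓘(ℝ, ℝ)).prod 𝓘(ℝ, ℝ)) q) + V.2 * W.2) ∧
      ∀ (q : (N × ℝ) × ℝ) (V W : TangentSpace ((I'.prod 𝓘(ℝ, ℝ)).prod 𝓘(ℝ, ℝ)) q),
        𝔊.val q V W = F q * G.val q.1 V.1 W.1 + (1 - F q) * (V.1.2 * W.1.2) + V.2 * W.2 := by
  set J := (I'.prod 𝓘(ℝ, ℝ)).prod 𝓘(ℝ, ℝ) with hJ
  -- the three pulled-back fields
  set A : Π q : (N × ℝ) × ℝ, TangentSpace J q →L[ℝ] TangentSpace J q →L[ℝ] ℝ :=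
    pullbackBilin (I := I'.prod 𝓘(ℝ, ℝ)) (I' := J) (Prod.fst : (N × ℝ) × ℝ → N × ℝ) G.val with hA
  set B : Π q : (N × ℝ) × ℝ, TangentSpace J q →L[ℝ] TangentSpace J q →L[ℝ] ℝ :=
    pullbackBilin (I := 𝓘(ℝ, ℝ)) (I' := J) (Prod.snd ∘ Prod.fst : (N × ℝ) × ℝ → ℝ)
      (euclideanMetric ℝ).val with hB
  set C : Π q : (N × ℝ) × ℝ, TangentSpace J q →L[ℝ] TangentSpace J q →L[ℝ] ℝ :=
    pullbackBilin (I := 𝓘(ℝ, ℝ)) (I' := J) (Prod.snd : (N × ℝ) × ℝ → ℝ)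
      (euclideanMetric ℝ).val with hC
  have hAapply : ∀ (q : (N × ℝ) × ℝ) (V W : TangentSpace J q), A q V W = G.val q.1 V.1 W.1 := by
    intro q V W
    rw [hA, pullbackBilin_apply, mfderiv_fst]
    rfl
  have hBapply : ∀ (q : (N × ℝ) × ℝ) (V W : TangentSpace J q), B q V W = V.1.2 * W.1.2 := by
    intro q V W
    rw [hB, pullbackBilin_apply, euclideanMetric_apply,
      mfderiv_comp q mdifferentiableAt_snd mdifferentiableAt_fst, mfderiv_snd, mfderiv_fst]
    show ⟪V.1.2, W.1.2⟫ = V.1.2 * W.1.2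
    rw [real_inner_comm]
    rfl
  have hCapply : ∀ (q : (N × ℝ) × ℝ) (V W : TangentSpace J q), C q V W = V.2 * W.2 := by
    intro q V W
    rw [hC, pullbackBilin_apply, euclideanMetric_apply, mfderiv_snd]
    show ⟪V.2, W.2⟫ = V.2 * W.2
    rw [real_inner_comm]
    rfl
  have hAs : ContMDiff J (J.prod 𝓘(ℝ, ((E' × ℝ) × ℝ) →L[ℝ] ((E' × ℝ) × ℝ) →L[ℝ] ℝ)) ∞
      (fun q : (N × ℝ) × ℝ ↦ TotalSpace.mk' (((E' × ℝ) × ℝ) →L[ℝ] ((E' × ℝ) × ℝ) →L[ℝ] ℝ)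
        (E := fun q : (N × ℝ) × ℝ ↦ TangentSpace J q →L[ℝ] TangentSpace J q →L[ℝ] ℝ) q (A q)) :=
    contMDiff_pullbackBilin_holds (I := I'.prod 𝓘(ℝ, ℝ)) (M := N × ℝ) (I' := J) (N := (N × ℝ) × ℝ)
      Prod.fst contMDiff_fst G
  have hBs : ContMDiff J (J.prod 𝓘(ℝ, ((E' × ℝ) × ℝ) →L[ℝ] ((E' × ℝ) × ℝ) →L[ℝ] ℝ)) ∞
      (fun q : (N × ℝ) × ℝ ↦ TotalSpace.mk' (((E' × ℝ) × ℝ) →L[ℝ] ((E' × ℝ) × ℝ) →L[ℝ] ℝ)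
        (E := fun q : (N × ℝ) × ℝ ↦ TangentSpace J q →L[ℝ] TangentSpace J q →L[ℝ] ℝ) q (B q)) :=
    contMDiff_pullbackBilin_holds (I := 𝓘(ℝ, ℝ)) (M := ℝ) (I' := J) (N := (N × ℝ) × ℝ)
      (Prod.snd ∘ Prod.fst) (contMDiff_snd.comp contMDiff_fst) (euclideanMetric ℝ)
  have hCs : ContMDiff J (J.prod 𝓘(ℝ, ((E' × ℝ) × ℝ) →L[ℝ] ((E' × ℝ) × ℝ) →L[ℝ] ℝ)) ∞
      (fun q : (N × ℝ) × ℝ ↦ TotalSpace.mk' (((E' × ℝ) × ℝ) →L[ℝ] ((E' × ℝ) × ℝ) →L[ℝ] ℝ)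
        (E := fun q : (N × ℝ) × ℝ ↦ TangentSpace J q →L[ℝ] TangentSpace J q →L[ℝ] ℝ) q (C q)) :=
    contMDiff_pullbackBilin_holds (I := 𝓘(ℝ, ℝ)) (M := ℝ) (I' := J) (N := (N × ℝ) × ℝ)
      Prod.snd contMDiff_snd (euclideanMetric ℝ)
  -- the glued field
  set val : Π q : (N × ℝ) × ℝ, TangentSpace J q →L[ℝ] TangentSpace J q →L[ℝ] ℝ :=
    fun q ↦ F q • A q + (1 - F q) • B q + C q with hval
  have hvapply : ∀ (q : (N × ℝ) × ℝ) (V W : TangentSpace J q),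
      val q V W = F q * G.val q.1 V.1 W.1 + (1 - F q) * (V.1.2 * W.1.2) + V.2 * W.2 := by
    intro q V W
    simp only [hval, _root_.add_apply, _root_.smul_apply, smul_eq_mul, hAapply, hBapply, hCapply]
  have hsmooth : ContMDiff J (J.prod 𝓘(ℝ, ((E' × ℝ) × ℝ) →L[ℝ] ((E' × ℝ) × ℝ) →L[ℝ] ℝ)) ∞
      (fun q : (N × ℝ) × ℝ ↦ TotalSpace.mk' (((E' × ℝ) × ℝ) →L[ℝ] ((E' × ℝ) × ℝ) →L[ℝ] ℝ)
        (E := fun q : (N × ℝ) × ℝ ↦ TangentSpace J q →L[ℝ] TangentSpace J q →L[ℝ] ℝ) q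
          (val q)) := by
    intro q
    have h1 : ContMDiffAt J (J.prod 𝓘(ℝ, ((E' × ℝ) × ℝ) →L[ℝ] ((E' × ℝ) × ℝ) →L[ℝ] ℝ)) ∞
        (fun q : (N × ℝ) × ℝ ↦ TotalSpace.mk' (((E' × ℝ) × ℝ) →L[ℝ] ((E' × ℝ) × ℝ) →L[ℝ] ℝ)
          (E := fun q : (N × ℝ) × ℝ ↦ TangentSpace J q →L[ℝ] TangentSpace J q →L[ℝ] ℝ) q
            ((F • A) q)) q :=
      (hF q).smul_section (hAs q)
    have h2 : ContMDiffAt J (J.prod 𝓘(ℝ, ((E' × ℝ) × ℝ) →L[ℝ] ((E' × ℝ) × ℝ) →L[ℝ] ℝ)) ∞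
        (fun q : (N × ℝ) × ℝ ↦ TotalSpace.mk' (((E' × ℝ) × ℝ) →L[ℝ] ((E' × ℝ) × ℝ) →L[ℝ] ℝ)
          (E := fun q : (N × ℝ) × ℝ ↦ TangentSpace J q →L[ℝ] TangentSpace J q →L[ℝ] ℝ) q
            (((fun q ↦ 1 - F q) • B) q)) q :=
      (contMDiffAt_const.sub (hF q)).smul_section (hBs q)
    exact (h1.add_section h2).add_section (hCs q)
  -- positivity
  have hvpos : ∀ (q : (N × ℝ) × ℝ) (V : TangentSpace J q), V ≠ 0 → 0 < val q V V := by
    intro q V hV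
    rw [hvapply, hcyl q.1 V.1 V.1]
    have hh := cyl_val_hor_self_nonneg G hG q.1 V.1.1
    have h12 : 0 ≤ V.1.2 * V.1.2 := mul_self_nonneg _
    have h2 : 0 ≤ V.2 * V.2 := mul_self_nonneg _
    have hF1 : 0 ≤ F q * G.val q.1 ((V.1.1, 0) : TangentSpace (I'.prod 𝓘(ℝ, ℝ)) q.1)
        ((V.1.1, 0) : TangentSpace (I'.prod 𝓘(ℝ, ℝ)) q.1) := mul_nonneg (hpos q).le hh
    -- the value is `F G_hor(V₁₁) + V₁₂² + V₂²`
    have hrw : F q * (G.val q.1 ((V.1.1, 0) : TangentSpace (I'.prod 𝓘(ℝ, ℝ)) q.1)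
        ((V.1.1, 0) : TangentSpace (I'.prod 𝓘(ℝ, ℝ)) q.1) + V.1.2 * V.1.2) +
        (1 - F q) * (V.1.2 * V.1.2) + V.2 * V.2 =
        F q * G.val q.1 ((V.1.1, 0) : TangentSpace (I'.prod 𝓘(ℝ, ℝ)) q.1)
          ((V.1.1, 0) : TangentSpace (I'.prod 𝓘(ℝ, ℝ)) q.1) + V.1.2 * V.1.2 + V.2 * V.2 := by ring
    rw [hrw]
    by_cases h11 : V.1.1 = 0
    · by_cases h12' : V.1.2 = 0
      · have h2' : V.2 ≠ 0 := fun h ↦ hV (Prod.ext (Prod.ext h11 h12') h)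
        have : 0 < V.2 * V.2 := mul_self_pos.2 h2'
        linarith
      · have : 0 < V.1.2 * V.1.2 := mul_self_pos.2 h12'
        linarith
    · have h3 : 0 < G.val q.1 ((V.1.1, 0) : TangentSpace (I'.prod 𝓘(ℝ, ℝ)) q.1)
          ((V.1.1, 0) : TangentSpace (I'.prod 𝓘(ℝ, ℝ)) q.1) := cyl_val_hor_self_pos G hG q.1 h11
      have h4 := mul_pos (hpos q) h3
      linarith
  refine ⟨⟨val, ?_, ?_, hsmooth⟩, fun q V hV ↦ hvpos q V hV, ?_, hvapply⟩
  · intro q V W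
    rw [hvapply, hvapply, G.symm q.1 V.1 W.1, mul_comm V.1.2 W.1.2, mul_comm V.2 W.2]
  · intro q V hV
    by_contra hne
    exact (hvpos q V hne).ne' (hV V)
  · intro q V W
    show val q V W = val q _ _ + V.2 * W.2
    rw [hvapply, hvapply]
    show _ = F q * G.val q.1 V.1 W.1 + (1 - F q) * (V.1.2 * W.1.2) + (0 : ℝ) * 0 + V.2 * W.2
    ring

end Suspension

/-! ### The scalar curvature of `Γ_δ` through the suspension -/

section ScalarCurvature

variable (G : PseudoRiemannianMetric (I'.prod 𝓘(ℝ, ℝ)) ∞ (E' × ℝ)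
    (TangentSpace (I'.prod 𝓘(ℝ, ℝ)) : N × ℝ → Type _))
  (hcyl : ∀ (p : N × ℝ) (v w : TangentSpace (I'.prod 𝓘(ℝ, ℝ)) p),
    G.val p v w = G.val p ((v.1, 0) : TangentSpace (I'.prod 𝓘(ℝ, ℝ)) p)
      ((w.1, 0) : TangentSpace (I'.prod 𝓘(ℝ, ℝ)) p) + v.2 * w.2)
  (φ : N × ℝ → ℝ)
  (Γ : ℝ → PseudoRiemannianMetric (I'.prod 𝓘(ℝ, ℝ)) ∞ (E' × ℝ)
    (TangentSpace (I'.prod 𝓘(ℝ, ℝ)) : N × ℝ → Type _)) [∀ δ, (Γ δ).HasLeviCivita]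
  (hΓval : ∀ (δ : ℝ) (p : N × ℝ) (v w : TangentSpace (I'.prod 𝓘(ℝ, ℝ)) p),
    (Γ δ).val p v w = Real.exp (δ * φ p) * G.val p v w + (1 - Real.exp (δ * φ p)) * (v.2 * w.2))
  (𝔊 : PseudoRiemannianMetric ((I'.prod 𝓘(ℝ, ℝ)).prod 𝓘(ℝ, ℝ)) ∞ ((E' × ℝ) × ℝ)
    (TangentSpace ((I'.prod 𝓘(ℝ, ℝ)).prod 𝓘(ℝ, ℝ)) : (N × ℝ) × ℝ → Type _)) [𝔊.HasLeviCivita]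
  (h𝔊 : 𝔊.IsRiemannian)
  (h𝔊cyl : ∀ (q : (N × ℝ) × ℝ) (V W : TangentSpace ((I'.prod 𝓘(ℝ, ℝ)).prod 𝓘(ℝ, ℝ)) q),
    𝔊.val q V W = 𝔊.val q ((V.1, 0) : TangentSpace ((I'.prod 𝓘(ℝ, ℝ)).prod 𝓘(ℝ, ℝ)) q)
      ((W.1, 0) : TangentSpace ((I'.prod 𝓘(ℝ, ℝ)).prod 𝓘(ℝ, ℝ)) q) + V.2 * W.2)
  (h𝔊val : ∀ (q : (N × ℝ) × ℝ) (V W : TangentSpace ((I'.prod 𝓘(ℝ, ℝ)).prod 𝓘(ℝ, ℝ)) q),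
    𝔊.val q V W = Real.exp (q.2 * φ q.1) * G.val q.1 V.1 W.1 +
      (1 - Real.exp (q.2 * φ q.1)) * (V.1.2 * W.1.2) + V.2 * W.2)

omit [FiniteDimensional ℝ E'] [I'.Boundaryless] [∀ δ, (Γ δ).HasLeviCivita] in
include hcyl hΓval in
/-- The deformed metrics `Γ_δ` have the cylinder property. [folklore] -/
theorem cyl_of_val (δ : ℝ) (p : N × ℝ) (v w : TangentSpace (I'.prod 𝓘(ℝ, ℝ)) p) :
    (Γ δ).val p v w = (Γ δ).val p ((v.1, 0) : TangentSpace (I'.prod 𝓘(ℝ, ℝ)) p)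
      ((w.1, 0) : TangentSpace (I'.prod 𝓘(ℝ, ℝ)) p) + v.2 * w.2 := by
  rw [hΓval, hΓval, hcyl p v w]
  show _ = Real.exp (δ * φ p) * G.val p ((v.1, 0) : TangentSpace (I'.prod 𝓘(ℝ, ℝ)) p)
    ((w.1, 0) : TangentSpace (I'.prod 𝓘(ℝ, ℝ)) p) + (1 - Real.exp (δ * φ p)) * ((0 : ℝ) * 0) +
    v.2 * w.2
  ring

omit [FiniteDimensional ℝ E'] [I'.Boundaryless] [∀ δ, (Γ δ).HasLeviCivita] [𝔊.HasLeviCivita] in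
include hΓval h𝔊val in
/-- The `δ`-slice of the suspension is `Γ_δ`: `𝔊_{(p,δ)}((v,0),(w,0)) = (Γ_δ)_p(v, w)`. [folklore] -/
theorem suspension_val_hor (p : N × ℝ) (δ : ℝ) (v w : TangentSpace (I'.prod 𝓘(ℝ, ℝ)) p) :
    𝔊.val (p, δ) ((v, 0) : TangentSpace ((I'.prod 𝓘(ℝ, ℝ)).prod 𝓘(ℝ, ℝ)) (p, δ))
        ((w, 0) : TangentSpace ((I'.prod 𝓘(ℝ, ℝ)).prod 𝓘(ℝ, ℝ)) (p, δ)) = (Γ δ).val p v w := by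
  rw [h𝔊val, hΓval]
  show Real.exp (δ * φ p) * G.val p v w + (1 - Real.exp (δ * φ p)) * (v.2 * w.2) + (0 : ℝ) * 0 = _
  ring

omit [∀ δ, (Γ δ).HasLeviCivita] in
include hΓval h𝔊val h𝔊cyl in
set_option maxHeartbeats 1600000 in
/-- **The second fundamental form of the `δ`-slices of the suspension**:
`2 K_δ(V, W) = φ(p) ((Γ_δ)_p(V, W) − V₂ W₂)`, i.e. `K_δ = ½ φ · (Γ_δ − dt²)` (the coefficient
`τ ↦ 𝔊_{(p,τ)}((V,0),(W,0)) = e^{τφ(p)} (G(V,W) − V₂W₂) + V₂W₂` has `τ`-derivative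
`φ(p) e^{δφ(p)} (G(V,W) − V₂W₂)` at `δ`; `hasDerivAt_cyl_val_two_mul`). [folklore] -/
theorem two_mul_secondFundamentalForm_suspension (p : N × ℝ) (δ : ℝ)
    (V W : TangentSpace (I'.prod 𝓘(ℝ, ℝ)) p) :
    2 * 𝔊.secondFundamentalForm (I'.prod 𝓘(ℝ, ℝ)) (fun y : N × ℝ ↦ ((y, δ) : (N × ℝ) × ℝ))
        (fun y ↦ velocity ((I'.prod 𝓘(ℝ, ℝ)).prod 𝓘(ℝ, ℝ)) (fun s : ℝ ↦ ((y, s) : (N × ℝ) × ℝ)) δ)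
        p V W =
      φ p * ((Γ δ).val p V W - V.2 * W.2) := by
  have h1 := hasDerivAt_cyl_val_two_mul 𝔊 h𝔊cyl p δ V W
  have h2 : HasDerivAt (fun τ : ℝ ↦ Real.exp (τ * φ p) * (G.val p V W - V.2 * W.2) + V.2 * W.2)
      (φ p * Real.exp (δ * φ p) * (G.val p V W - V.2 * W.2)) δ := by
    have he : HasDerivAt (fun τ : ℝ ↦ Real.exp (τ * φ p)) (Real.exp (δ * φ p) * (1 * φ p)) δ :=
      (((hasDerivAt_id δ).mul_const (φ p)).exp)
    have := (he.mul_const (G.val p V W - V.2 * W.2)).add_const (V.2 * W.2)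
    exact this.congr_deriv (by ring)
  have h1' : HasDerivAt (fun τ : ℝ ↦ Real.exp (τ * φ p) * (G.val p V W - V.2 * W.2) + V.2 * W.2)
      (2 * 𝔊.secondFundamentalForm (I'.prod 𝓘(ℝ, ℝ)) (fun y : N × ℝ ↦ ((y, δ) : (N × ℝ) × ℝ))
        (fun y ↦ velocity ((I'.prod 𝓘(ℝ, ℝ)).prod 𝓘(ℝ, ℝ)) (fun s : ℝ ↦ ((y, s) : (N × ℝ) × ℝ)) δ)
        p V W) δ := by
    refine h1.congr_of_eventuallyEq (Eventually.of_forall fun τ ↦ ?_)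
    show _ = 𝔊.val (p, τ) _ _
    rw [h𝔊val]
    show _ = Real.exp (τ * φ p) * G.val p V W + (1 - Real.exp (τ * φ p)) * (V.2 * W.2) + (0 : ℝ) * 0
    ring
  have h := h1'.unique h2
  rw [h, hΓval]
  ring

omit [∀ δ, (Γ δ).HasLeviCivita] in
include hcyl hΓval h𝔊val h𝔊cyl in
set_option maxHeartbeats 1600000 in
/-- **The mean curvature of the `δ`-slices of the suspension is `½ φ dim N`** (independent of
`δ`): `H_δ(p) = tr_{Γ_δ}(½ φ (Γ_δ − dt²)) = ½ φ(p) dim N` (`trace_hor_eq_finrank`). [folklore] -/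
theorem meanCurvature_suspension (p : N × ℝ) (δ : ℝ) :
    𝔊.meanCurvature (fun y : N × ℝ ↦ ((y, δ) : (N × ℝ) × ℝ))
        (contMDiff_pullbackBilin_holds (I := (I'.prod 𝓘(ℝ, ℝ)).prod 𝓘(ℝ, ℝ)) (M := (N × ℝ) × ℝ)
          (I' := I'.prod 𝓘(ℝ, ℝ)) (N := N × ℝ))
        (isSpacelikeImmersion_cylSlice 𝔊 h𝔊 δ)
        (fun y ↦ velocity ((I'.prod 𝓘(ℝ, ℝ)).prod 𝓘(ℝ, ℝ)) (fun s : ℝ ↦ ((y, s) : (N × ℝ) × ℝ)) δ) p =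
      φ p / 2 * Module.finrank ℝ E' := by
  set K := 𝔊.secondFundamentalForm (I'.prod 𝓘(ℝ, ℝ)) (fun y : N × ℝ ↦ ((y, δ) : (N × ℝ) × ℝ))
    (fun y ↦ velocity ((I'.prod 𝓘(ℝ, ℝ)).prod 𝓘(ℝ, ℝ)) (fun s : ℝ ↦ ((y, s) : (N × ℝ) × ℝ)) δ) p
    with hK
  -- `K = (φ/2) • (Γ_δ − dt²)`
  set B : LinearMap.BilinForm ℝ (TangentSpace (I'.prod 𝓘(ℝ, ℝ)) p) := (2 / φ p) • K with hB
  have hslice : (𝔊.inducedMetric (fun y : N × ℝ ↦ ((y, δ) : (N × ℝ) × ℝ))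
      (contMDiff_pullbackBilin_holds (I := (I'.prod 𝓘(ℝ, ℝ)).prod 𝓘(ℝ, ℝ)) (M := (N × ℝ) × ℝ)
        (I' := I'.prod 𝓘(ℝ, ℝ)) (N := N × ℝ))
      (isSpacelikeImmersion_cylSlice 𝔊 h𝔊 δ)).val p = (Γ δ).val p := by
    refine ContinuousLinearMap.ext fun v ↦ ContinuousLinearMap.ext fun w ↦ ?_
    rw [inducedMetric_cylSlice_apply 𝔊 h𝔊, suspension_val_hor G φ Γ hΓval 𝔊 h𝔊val]
  unfold meanCurvature
  rw [trace_congr hslice, ← hK]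
  by_cases hφ : φ p = 0
  · -- `K = 0`
    have hK0 : K = 0 := by
      refine LinearMap.ext fun v ↦ LinearMap.ext fun w ↦ ?_
      have h := two_mul_secondFundamentalForm_suspension G φ Γ hΓval 𝔊 h𝔊cyl h𝔊val p δ v w
      rw [hφ, zero_mul] at h
      change K v w = (0 : LinearMap.BilinForm ℝ _) v w
      rw [LinearMap.zero_apply, LinearMap.zero_apply]
      linarith
    rw [hK0, hφ]
    simp [PseudoRiemannianMetric.trace]
  · have hKB : K = (φ p / 2) • B := by
      rw [hB, smul_smul]
      field_simp
      rw [one_smul]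
    have hBval : ∀ v w, B v w = (Γ δ).val p v w - v.2 * w.2 := by
      intro v w
      rw [hB, LinearMap.smul_apply, LinearMap.smul_apply, smul_eq_mul]
      have h := two_mul_secondFundamentalForm_suspension G φ Γ hΓval 𝔊 h𝔊cyl h𝔊val p δ v w
      change 2 * K v w = _ at h
      field_simp
      linarith
    rw [hKB]
    have hlin : (Γ δ).trace p ((φ p / 2) • B) = (φ p / 2) * (Γ δ).trace p B := by
      simp only [PseudoRiemannianMetric.trace, LinearMap.comp_smul, map_smul, smul_eq_mul]
    rw [hlin, trace_hor_eq_finrank (Γ δ) (cyl_of_val G hcyl φ Γ hΓval δ) p B hBval]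

/-- `normSq` depends on the metric only through its value at the point. [folklore] -/
theorem normSq_congr' {E : Type*} [NormedAddCommGroup E] [NormedSpace ℝ E] {H : Type*}
    [TopologicalSpace H] {I : ModelWithCorners ℝ E H} {M : Type*} [TopologicalSpace M]
    [ChartedSpace H M] [IsManifold I ∞ M] [FiniteDimensional ℝ E] {n : ℕ∞ω}
    {g₁ g₂ : PseudoRiemannianMetric I n E (TangentSpace I : M → Type _)}
    {b : M} (h : g₁.val b = g₂.val b) (T : LinearMap.BilinForm ℝ (TangentSpace I b)) :
    g₁.normSq b T = g₂.normSq b T := by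
  unfold PseudoRiemannianMetric.normSq
  rw [sharp_congr h]

/-- `|c T|²_g = c² |T|²_g`. [folklore] -/
theorem normSq_smul' {E : Type*} [NormedAddCommGroup E] [NormedSpace ℝ E] {H : Type*}
    [TopologicalSpace H] {I : ModelWithCorners ℝ E H} {M : Type*} [TopologicalSpace M]
    [ChartedSpace H M] [IsManifold I ∞ M] [FiniteDimensional ℝ E] {n : ℕ∞ω}
    (g : PseudoRiemannianMetric I n E (TangentSpace I : M → Type _))
    (b : M) (c : ℝ) (T : LinearMap.BilinForm ℝ (TangentSpace I b)) :
    g.normSq b (c • T) = c ^ 2 * g.normSq b T := by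
  have hflip : (c • T).flip = c • T.flip :=
    LinearMap.ext fun v ↦ LinearMap.ext fun w ↦ rfl
  unfold PseudoRiemannianMetric.normSq
  rw [hflip, LinearMap.comp_smul, LinearMap.comp_smul, LinearMap.smul_comp, LinearMap.comp_smul,
    map_smul, map_smul, smul_eq_mul, smul_eq_mul]
  ring

omit [∀ δ, (Γ δ).HasLeviCivita] in
include hcyl hΓval h𝔊val h𝔊cyl in
set_option maxHeartbeats 1600000 in
/-- **`|K_δ|² = ¼ φ² dim N`** for the `δ`-slices of the suspension (`normSq_hor_eq_finrank`).
[folklore] -/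
theorem normSq_secondFundamentalForm_suspension (p : N × ℝ) (δ : ℝ) :
    (𝔊.inducedMetric (fun y : N × ℝ ↦ ((y, δ) : (N × ℝ) × ℝ))
        (contMDiff_pullbackBilin_holds (I := (I'.prod 𝓘(ℝ, ℝ)).prod 𝓘(ℝ, ℝ)) (M := (N × ℝ) × ℝ)
          (I' := I'.prod 𝓘(ℝ, ℝ)) (N := N × ℝ))
        (isSpacelikeImmersion_cylSlice 𝔊 h𝔊 δ)).normSq p
      (𝔊.secondFundamentalForm (I'.prod 𝓘(ℝ, ℝ)) (fun y : N × ℝ ↦ ((y, δ) : (N × ℝ) × ℝ))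
        (fun y ↦ velocity ((I'.prod 𝓘(ℝ, ℝ)).prod 𝓘(ℝ, ℝ)) (fun s : ℝ ↦ ((y, s) : (N × ℝ) × ℝ)) δ)
        p) =
      (φ p / 2) ^ 2 * Module.finrank ℝ E' := by
  set K := 𝔊.secondFundamentalForm (I'.prod 𝓘(ℝ, ℝ)) (fun y : N × ℝ ↦ ((y, δ) : (N × ℝ) × ℝ))
    (fun y ↦ velocity ((I'.prod 𝓘(ℝ, ℝ)).prod 𝓘(ℝ, ℝ)) (fun s : ℝ ↦ ((y, s) : (N × ℝ) × ℝ)) δ) p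
    with hK
  set B : LinearMap.BilinForm ℝ (TangentSpace (I'.prod 𝓘(ℝ, ℝ)) p) := (2 / φ p) • K with hB
  have hslice : (𝔊.inducedMetric (fun y : N × ℝ ↦ ((y, δ) : (N × ℝ) × ℝ))
      (contMDiff_pullbackBilin_holds (I := (I'.prod 𝓘(ℝ, ℝ)).prod 𝓘(ℝ, ℝ)) (M := (N × ℝ) × ℝ)
        (I' := I'.prod 𝓘(ℝ, ℝ)) (N := N × ℝ))
      (isSpacelikeImmersion_cylSlice 𝔊 h𝔊 δ)).val p = (Γ δ).val p := by
    refine ContinuousLinearMap.ext fun v ↦ ContinuousLinearMap.ext fun w ↦ ?_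
    rw [inducedMetric_cylSlice_apply 𝔊 h𝔊, suspension_val_hor G φ Γ hΓval 𝔊 h𝔊val]
  rw [normSq_congr' hslice]
  by_cases hφ : φ p = 0
  · have hK0 : K = 0 := by
      refine LinearMap.ext fun v ↦ LinearMap.ext fun w ↦ ?_
      have h := two_mul_secondFundamentalForm_suspension G φ Γ hΓval 𝔊 h𝔊cyl h𝔊val p δ v w
      rw [hφ, zero_mul] at h
      change K v w = (0 : LinearMap.BilinForm ℝ _) v w
      rw [LinearMap.zero_apply, LinearMap.zero_apply]
      linarith
    rw [hK0, hφ, normSq_zero]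
    ring
  · have hKB : K = (φ p / 2) • B := by
      rw [hB, smul_smul]
      field_simp
      rw [one_smul]
    have hBval : ∀ v w, B v w = (Γ δ).val p v w - v.2 * w.2 := by
      intro v w
      rw [hB, LinearMap.smul_apply, LinearMap.smul_apply, smul_eq_mul]
      have h := two_mul_secondFundamentalForm_suspension G φ Γ hΓval 𝔊 h𝔊cyl h𝔊val p δ v w
      change 2 * K v w = _ at h
      field_simp
      linarith
    rw [hKB]
    rw [normSq_smul', normSq_hor_eq_finrank (Γ δ) (cyl_of_val G hcyl φ Γ hΓval δ) p B hBval]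

include hcyl hΓval h𝔊 h𝔊val h𝔊cyl in
set_option maxHeartbeats 1600000 in
/-- **The scalar curvature of the deformed cylinders through the suspension**:
`scal_{Γ_δ}(p) = scal_𝔊(p, δ) + ¼ d (d + 1) φ(p)²`, `d = dim N` — the generalized-cylinder
formula `scal_𝔊 = scal_{slice} − |K|² − H² − 2 ∂_δ H` (`cyl_scalarCurvature_eq`, Bär–Hanke (9))
for `𝔊` in the `δ`-direction, with `|K|² = ¼φ²d`, `H = ½φd` and `∂_δ H = 0`.
[cite: BarHanke2023, §3, (9) and proof of Prop. 28] -/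
theorem scalarCurvature_eq_suspension (p : N × ℝ) (δ : ℝ) :
    (Γ δ).scalarCurvature p = 𝔊.scalarCurvature (p, δ) +
      (Module.finrank ℝ E' * (Module.finrank ℝ E' + 1) / 4) * φ p ^ 2 := by
  have hpb := contMDiff_pullbackBilin_holds (I := (I'.prod 𝓘(ℝ, ℝ)).prod 𝓘(ℝ, ℝ))
    (M := (N × ℝ) × ℝ) (I' := I'.prod 𝓘(ℝ, ℝ)) (N := N × ℝ) (n := (∞ : ℕ∞ω))
  have hcyleq := cyl_scalarCurvature_eq 𝔊 h𝔊 h𝔊cyl p δ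
  -- the slice metric is `Γ_δ` in values
  have hslice : ∀ y, (𝔊.inducedMetric (fun y : N × ℝ ↦ ((y, δ) : (N × ℝ) × ℝ))
      (contMDiff_pullbackBilin_holds (I := (I'.prod 𝓘(ℝ, ℝ)).prod 𝓘(ℝ, ℝ)) (M := (N × ℝ) × ℝ)
        (I' := I'.prod 𝓘(ℝ, ℝ)) (N := N × ℝ))
      (isSpacelikeImmersion_cylSlice 𝔊 h𝔊 δ)).val y = (Γ δ).val y := by
    intro y
    refine ContinuousLinearMap.ext fun v ↦ ContinuousLinearMap.ext fun w ↦ ?_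
    rw [inducedMetric_cylSlice_apply 𝔊 h𝔊, suspension_val_hor G φ Γ hΓval 𝔊 h𝔊val]
  haveI := (𝔊.inducedMetric (fun y : N × ℝ ↦ ((y, δ) : (N × ℝ) × ℝ))
      (contMDiff_pullbackBilin_holds (I := (I'.prod 𝓘(ℝ, ℝ)).prod 𝓘(ℝ, ℝ)) (M := (N × ℝ) × ℝ)
        (I' := I'.prod 𝓘(ℝ, ℝ)) (N := N × ℝ))
      (isSpacelikeImmersion_cylSlice 𝔊 h𝔊 δ)).hasLeviCivita
  have hscal : (𝔊.inducedMetric (fun y : N × ℝ ↦ ((y, δ) : (N × ℝ) × ℝ))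
      (contMDiff_pullbackBilin_holds (I := (I'.prod 𝓘(ℝ, ℝ)).prod 𝓘(ℝ, ℝ)) (M := (N × ℝ) × ℝ)
        (I' := I'.prod 𝓘(ℝ, ℝ)) (N := N × ℝ))
      (isSpacelikeImmersion_cylSlice 𝔊 h𝔊 δ)).scalarCurvature p = (Γ δ).scalarCurvature p :=
    scalarCurvature_congr_of_val_eq hslice p
  -- `H` is constant in `δ`
  have hH : (fun τ ↦ 𝔊.meanCurvature (fun y : N × ℝ ↦ ((y, τ) : (N × ℝ) × ℝ))
      (contMDiff_pullbackBilin_holds (I := (I'.prod 𝓘(ℝ, ℝ)).prod 𝓘(ℝ, ℝ)) (M := (N × ℝ) × ℝ)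
        (I' := I'.prod 𝓘(ℝ, ℝ)) (N := N × ℝ))
      (isSpacelikeImmersion_cylSlice 𝔊 h𝔊 τ)
      (fun y ↦ velocity ((I'.prod 𝓘(ℝ, ℝ)).prod 𝓘(ℝ, ℝ)) (fun s : ℝ ↦ ((y, s) : (N × ℝ) × ℝ)) τ) p) =
      fun _ ↦ φ p / 2 * Module.finrank ℝ E' :=
    funext fun τ ↦ meanCurvature_suspension G hcyl φ Γ hΓval 𝔊 h𝔊 h𝔊cyl h𝔊val p τ
  rw [hscal, hH, normSq_secondFundamentalForm_suspension G hcyl φ Γ hΓval 𝔊 h𝔊 h𝔊cyl h𝔊val p δ,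
    meanCurvature_suspension G hcyl φ Γ hΓval 𝔊 h𝔊 h𝔊cyl h𝔊val p δ, deriv_const] at hcyleq
  linear_combination (-1 : ℝ) * hcyleq

include hcyl hΓval h𝔊 h𝔊val h𝔊cyl in
/-- **Joint continuity of the scalar curvature of the deformed cylinders in `(point, δ)`**:
`(p, δ) ↦ scal_{Γ_δ}(p)` is continuous on `(N × ℝ) × ℝ` (`scalarCurvature_eq_suspension` and
continuity of the scalar curvature of the smooth metric `𝔊`). This is the tree's rendering of
Bär–Hanke's "`f^δ → g` in the weak `C^∞`-topology as `δ → 0`, hence `scal_{f^δ} > σ` for small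
`δ`" for `φ` continuous. [cite: BarHanke2023, §3, proof of Prop. 28] -/
theorem continuous_scalarCurvature_family (hφ : Continuous φ) :
    Continuous fun q : (N × ℝ) × ℝ ↦ (Γ q.2).scalarCurvature q.1 := by
  have h : (fun q : (N × ℝ) × ℝ ↦ (Γ q.2).scalarCurvature q.1) = fun q ↦ 𝔊.scalarCurvature q +
      (Module.finrank ℝ E' * (Module.finrank ℝ E' + 1) / 4) * φ q.1 ^ 2 := by
    funext q
    obtain ⟨p, δ⟩ := q
    exact scalarCurvature_eq_suspension G hcyl φ Γ hΓval 𝔊 h𝔊 h𝔊cyl h𝔊val p δ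
  rw [h]
  exact (continuous_scalarCurvature_of_two_le 𝔊 (by exact WithTop.coe_le_coe.2 le_top)).add
    (continuous_const.mul ((hφ.comp continuous_fst).pow 2))

end ScalarCurvature

end Literature.Geometry.Riemannian
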